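import Literature.AlgebraicGeometry.Resolution.CofinalityFromPrincipalizationAssembly
import Literature.AlgebraicGeometry.Resolution.MonoidalTransformStep
import Literature.AlgebraicGeometry.Resolution.DecompositionLayerAssembly
import HarnessLib

/-!
# [CoP1] Prop. 8.1, first half without denominators: a local uniformization above `R₁′` principalizing `m_{R₁′}`

Topic: `Literature/AlgebraicGeometry/Resolution`. PROOF side of `CossartPiltant2019ReductionP`
(`ArithmeticalThreefoldsLocal.lean`), input (C4), head `hHead` of
`cossartPiltant2019ReductionP_of_cjs_of_stableInertia_of_head`. The printed proof of [CoP1]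
Prop. 8.1 (V. Cossart, O. Piltant, HAL hal-00139124, p. 22) starts: "There exists a local
uniformization `S₁` of `W/k` such that `S₀ < S₁` by corollary 4.6. Since `S₀` and `S₁` are
birational … there exists `g ∈ m_{S₀}`, `g ≠ 0` such that `(S₀)_g = (S₁)_g`." and then
principalizes `m_{S₀} S₁` (part of Prop. 4.1's job). This file PROVES this PRE-STAGE in the
frame of the head (`exists_preStage`): from a local uniformization of `K′` (`hLUK′`) and the
models `S[t₁] ⊆ M`, `S[t₁ ∪ t₁′] ⊆ K′` of `hHead`, cofinality
(`exists_model_mem_localRing_of_principalization`, hypothesis `CossartPiltant2019Principalization`)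
yields a regular model `S[t] ⊇ S[t₁ ∪ t₁′]`, `t ⊆ K′`, whose local ring contains
`R₁′ = (S[t₁ ∪ t₁′])_𝔪` and in which `m_{R₁′}` becomes principal, generated by an element
`h₀ ∈ S[t₁ ∪ t₁′]`; together with the common denominator `q ∈ S[t₁ ∪ t₁′]` of the generators
`t` ("`(S₀)_g = (S₁)_g`" in the model reading: `q t ⊆ S[t₁ ∪ t₁′]`). No denominator CONTROL is
needed at this stage (the tracking element is chosen afterwards); the remaining monomialization
step is the one that needs it (`ModelDenominatorTracking.lean`).

Everything is PROVED; no named facts, definitions, instances or notation are introduced.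

## Sources

* V. Cossart, O. Piltant, J. Algebra 320 (2008) 1051–1082: proof of Prop. 8.1, first paragraph,
  and Cor. 4.6 (HAL hal-00139124, pp. 14, 22). [CossartPiltant2008]
-/

noncomputable section

open AlgebraicGeometry CategoryTheory

namespace Literature.AlgebraicGeometry.Resolution

universe u

open IsLocalRing _root_.Polynomial Function

section PreStage

variable {S : Type u} [CommRing S] [IsRegularLocalRing S] {E : Type u} [Field E] [Algebra S E]
  [Algebra.IsAlgebraic S E]

omit [IsRegularLocalRing S] [Algebra.IsAlgebraic S E] in
/-- Adjoining an element of the local ring of a model does not change the local ring.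
[cite: CossartPiltant2008, §2.1 (HAL pp. 8–9)] -/
theorem locAtCentre_adjoin_insert_eq_of_mem (O : ValuationSubring E) (t : Set E) {x : E}
    (hx : x ∈ locAtCentre (Algebra.adjoin S t).toSubring O) :
    locAtCentre (Algebra.adjoin S (insert x t)).toSubring O =
      locAtCentre (Algebra.adjoin S t).toSubring O := by
  refine le_antisymm ?_ (locAtCentre_mono O (Algebra.adjoin_mono (Set.subset_insert _ _)))
  have h1 : (Algebra.adjoin S (insert x t)).toSubring ≤ locAtCentre (Algebra.adjoin S t).toSubring O := by
    let C : Subalgebra S E :=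
      { locAtCentre (Algebra.adjoin S t).toSubring O with
        algebraMap_mem' := fun r => le_locAtCentre _ _ ((Algebra.adjoin S t).algebraMap_mem r) }
    have : Algebra.adjoin S (insert x t) ≤ C := by
      refine Algebra.adjoin_le ?_
      rintro y (rfl | hy)
      · exact hx
      · exact le_locAtCentre _ _ (Algebra.subset_adjoin hy)
    exact fun y hy => this hy
  have h2 := locAtCentre_mono O h1
  rwa [locAtCentre_locAtCentre] at h2

set_option maxHeartbeats 800000 in
/-- **Cofinality, one element, keeping the element among the generators** ([CoP1] Cor. 4.6):
in the frame, a local uniformization `S[t]` of `K′` (`t ⊆ K′`, `K′ = Frac`, regular at the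
centre) can be refined to one, `S[t′]` with `t ⊆ t′ ⊆ K′`, containing a given `x ∈ K′ ∩ O_E`
AMONG ITS GENERATORS. [cite: CossartPiltant2008, Cor. 4.6 (HAL p. 14)] [cite: CossartPiltant2019, Prop. 4.4] -/
theorem exists_lu_insert (h44 : CossartPiltant2019Principalization.{u})
    (hS : IsExcellentRing S) (hSdim : ringKrullDim S = 3)
    (hinj : Function.Injective (algebraMap S E))
    (OE : ValuationSubring E) (hSO : ∀ s : S, algebraMap S E s ∈ OE)
    (hdom : ∀ s ∈ maximalIdeal S, OE.valuation (algebraMap S E s) < 1)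
    (hres : ∀ y : OE, ∃ q : S[X], (∃ i, q.coeff i ∉ maximalIdeal S) ∧
      OE.valuation (q.eval₂ (algebraMap S E) y) < 1)
    (K' : Subfield E) (hSK : ∀ s : S, algebraMap S E s ∈ K')
    (t : Finset E) (htK : (t : Set E) ⊆ K')
    (hKcl : K' ≤ Subfield.closure (Set.range (algebraMap S E) ∪ (t : Set E)))
    (hTO : (Algebra.adjoin S (t : Set E)).toSubring ≤ OE.toSubring)
    (hreg : IsRegularLocalRing (locAtCentre (Algebra.adjoin S (t : Set E)).toSubring OE))
    (x : E) (hxK : x ∈ K') (hxO : x ∈ OE) :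
    ∃ t' : Finset E, t ⊆ t' ∧ x ∈ t' ∧ (t' : Set E) ⊆ K' ∧
      K' ≤ Subfield.closure (Set.range (algebraMap S E) ∪ (t' : Set E)) ∧
      ∃ _ : (Algebra.adjoin S (t' : Set E)).toSubring ≤ OE.toSubring,
        IsRegularLocalRing (locAtCentre (Algebra.adjoin S (t' : Set E)).toSubring OE) := by
  classical
  obtain ⟨t₁, htt₁, ht₁K, hKcl₁, hT₁O, hreg₁, a, s, ha, hs, hvs, hxs⟩ :=
    exists_model_mem_localRing_of_principalization h44 hS hSdim hinj OE hSO hdom hres K' hSK t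
      htK hKcl hTO ((isRegularLocalRing_locAtCentre_iff hTO).mp hreg) x hxK hxO
  have hreg₁' : IsRegularLocalRing (locAtCentre (Algebra.adjoin S (t₁ : Set E)).toSubring OE) :=
    (isRegularLocalRing_locAtCentre_iff hT₁O).mpr hreg₁
  have hxR : x ∈ locAtCentre (Algebra.adjoin S (t₁ : Set E)).toSubring OE := by
    refine ⟨a, ha, s, hs, hvs, ?_⟩
    rw [eq_div_iff (ne_zero_of_valuation_eq_one hvs), hxs]
  have hEq : locAtCentre (Algebra.adjoin S (insert x (t₁ : Set E))).toSubring OE =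
      locAtCentre (Algebra.adjoin S (t₁ : Set E)).toSubring OE :=
    locAtCentre_adjoin_insert_eq_of_mem OE (t₁ : Set E) hxR
  have hT₂O : (Algebra.adjoin S (insert x (t₁ : Set E))).toSubring ≤ OE.toSubring :=
    model_toSubring_le_valuationSubring OE hSO fun y hy => by
      rcases hy with rfl | hy
      · exact hxO
      · exact hT₁O (Algebra.subset_adjoin hy)
  refine ⟨insert x t₁, htt₁.trans (Finset.subset_insert _ _), Finset.mem_insert_self _ _, ?_, ?_,
    ?_⟩
  · rw [Finset.coe_insert]; exact Set.insert_subset hxK ht₁K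
  · rw [Finset.coe_insert]
    exact hKcl₁.trans (Subfield.closure_mono (Set.union_subset_union_right _ (Set.subset_insert _ _)))
  · refine ⟨by rw [Finset.coe_insert]; exact hT₂O, ?_⟩
    rw [Finset.coe_insert, hEq]
    exact hreg₁'

set_option maxHeartbeats 800000 in
/-- **Cofinality for finitely many elements** ([CoP1] Cor. 4.6: "By induction on `n`, it can
then be assumed that `A₀ ⊆ R′`"): a local uniformization of `K′` refined to contain a given
finite set `P ⊆ K′ ∩ O_E` among its generators.
[cite: CossartPiltant2008, Cor. 4.6 (HAL p. 14)] [cite: CossartPiltant2019, Prop. 4.4] -/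
theorem exists_lu_superset (h44 : CossartPiltant2019Principalization.{u})
    (hS : IsExcellentRing S) (hSdim : ringKrullDim S = 3)
    (hinj : Function.Injective (algebraMap S E))
    (OE : ValuationSubring E) (hSO : ∀ s : S, algebraMap S E s ∈ OE)
    (hdom : ∀ s ∈ maximalIdeal S, OE.valuation (algebraMap S E s) < 1)
    (hres : ∀ y : OE, ∃ q : S[X], (∃ i, q.coeff i ∉ maximalIdeal S) ∧
      OE.valuation (q.eval₂ (algebraMap S E) y) < 1)
    (K' : Subfield E) (hSK : ∀ s : S, algebraMap S E s ∈ K') (P : Finset E)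
    (hPK : (P : Set E) ⊆ K') (hPO : ∀ x ∈ P, x ∈ OE) :
    ∀ (t : Finset E), (t : Set E) ⊆ K' →
      K' ≤ Subfield.closure (Set.range (algebraMap S E) ∪ (t : Set E)) →
      ∀ hTO : (Algebra.adjoin S (t : Set E)).toSubring ≤ OE.toSubring,
      IsRegularLocalRing (locAtCentre (Algebra.adjoin S (t : Set E)).toSubring OE) →
    ∃ t' : Finset E, t ⊆ t' ∧ P ⊆ t' ∧ (t' : Set E) ⊆ K' ∧
      K' ≤ Subfield.closure (Set.range (algebraMap S E) ∪ (t' : Set E)) ∧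
      ∃ _ : (Algebra.adjoin S (t' : Set E)).toSubring ≤ OE.toSubring,
        IsRegularLocalRing (locAtCentre (Algebra.adjoin S (t' : Set E)).toSubring OE) := by
  classical
  induction P using Finset.induction_on with
  | empty =>
    intro t htK hKcl hTO hreg
    exact ⟨t, le_rfl, Finset.empty_subset _, htK, hKcl, hTO, hreg⟩
  | insert x P₀ hxP₀ ih =>
    intro t htK hKcl hTO hreg
    have hP₀K : (P₀ : Set E) ⊆ K' := fun y hy =>
      hPK (by rw [Finset.coe_insert]; exact Set.mem_insert_of_mem _ hy)
    have hP₀O : ∀ y ∈ P₀, y ∈ OE := fun y hy => hPO y (Finset.mem_insert_of_mem hy)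
    obtain ⟨t₁, htt₁, hP₀t₁, ht₁K, hKcl₁, hT₁O, hreg₁⟩ := ih hP₀K hP₀O t htK hKcl hTO hreg
    have hxK : x ∈ K' := hPK (by rw [Finset.coe_insert]; exact Set.mem_insert _ _)
    obtain ⟨t₂, ht₁t₂, hxt₂, ht₂K, hKcl₂, hT₂O, hreg₂⟩ :=
      exists_lu_insert h44 hS hSdim hinj OE hSO hdom hres K' hSK t₁ ht₁K hKcl₁ hT₁O hreg₁ x hxK
        (hPO x (Finset.mem_insert_self _ _))
    refine ⟨t₂, htt₁.trans ht₁t₂, ?_, ht₂K, hKcl₂, hT₂O, hreg₂⟩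
    intro y hy
    rcases Finset.mem_insert.mp hy with rfl | hy
    · exact hxt₂
    · exact ht₁t₂ (hP₀t₁ hy)

set_option maxHeartbeats 1600000 in
/-- **[CoP1] Prop. 8.1, the pre-stage `S₁`** (HAL p. 22, first paragraph, and the
principalization of `m_{S₀} S₁`), in the frame of the head of Prop. 9.3: a regular model
`S[t] ⊇ S[t₁ ∪ t₁′]`, `t ⊆ K′`, whose local ring contains `R₁′ = (S[t₁ ∪ t₁′])_𝔪` and in which
`m_{R₁′}` is generated by one element `h₀ ∈ S[t₁ ∪ t₁′]` (`h₀ ≠ 0`, `v(h₀) > 0`), together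
with a common denominator `q ∈ S[t₁ ∪ t₁′]`, `q ≠ 0`, of the generators: `q t ⊆ S[t₁ ∪ t₁′]`.
[cite: CossartPiltant2008, proof of Prop. 8.1 (HAL p. 22) and Cor. 4.6 (p. 14)]
[cite: CossartPiltant2019, Prop. 4.4] -/
theorem exists_preStage (h44 : CossartPiltant2019Principalization.{u})
    (hS : IsExcellentRing S) (hSdim : ringKrullDim S = 3)
    (hinj : Function.Injective (algebraMap S E))
    (OE : ValuationSubring E) (hSO : ∀ s : S, algebraMap S E s ∈ OE)
    (hdom : ∀ s ∈ maximalIdeal S, OE.valuation (algebraMap S E s) < 1)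
    (hres : ∀ y : OE, ∃ q : S[X], (∃ i, q.coeff i ∉ maximalIdeal S) ∧
      OE.valuation (q.eval₂ (algebraMap S E) y) < 1)
    (M K' : Subfield E) (hSM : ∀ s : S, algebraMap S E s ∈ M) (hMK' : M ≤ K')
    (hLUK' : ∃ t : Finset E, (t : Set E) ⊆ K' ∧
      K' ≤ Subfield.closure (Set.range (algebraMap S E) ∪ (t : Set E)) ∧
      ∃ hTO : (Algebra.adjoin S (t : Set E)).toSubring ≤ OE.toSubring,
        IsRegularLocalRing (Localization.AtPrime
          (Ideal.comap (Subring.inclusion hTO) (maximalIdeal OE))))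
    (t₁ : Finset E) (ht₁M : (t₁ : Set E) ⊆ M)
    (ht₁O : (Algebra.adjoin S (t₁ : Set E)).toSubring ≤ OE.toSubring)
    (t₁' : Finset E) (ht₁'K : (t₁' : Set E) ⊆ K')
    (hext : ∀ x : E, x ∈ K' → (IsIntegral (Algebra.adjoin S (t₁ : Set E)) x ↔
      x ∈ Algebra.adjoin S ((t₁ : Set E) ∪ (t₁' : Set E)))) :
    ∃ (t : Finset E), (t : Set E) ⊆ K' ∧
      Algebra.adjoin S ((t₁ : Set E) ∪ (t₁' : Set E)) ≤ Algebra.adjoin S (t : Set E) ∧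
      ∃ _ : (Algebra.adjoin S (t : Set E)).toSubring ≤ OE.toSubring,
        IsRegularLocalRing (locAtCentre (Algebra.adjoin S (t : Set E)).toSubring OE) ∧
        locAtCentre (Algebra.adjoin S ((t₁ : Set E) ∪ (t₁' : Set E))).toSubring OE ≤
          locAtCentre (Algebra.adjoin S (t : Set E)).toSubring OE ∧
        (∃ q : E, q ∈ Algebra.adjoin S ((t₁ : Set E) ∪ (t₁' : Set E)) ∧ q ≠ 0 ∧
          ∀ z ∈ (t : Set E), q * z ∈ Algebra.adjoin S ((t₁ : Set E) ∪ (t₁' : Set E))) ∧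
        (∃ h₀ : E, h₀ ∈ Algebra.adjoin S ((t₁ : Set E) ∪ (t₁' : Set E)) ∧ h₀ ≠ 0 ∧
          OE.valuation h₀ < 1 ∧
          ∀ y ∈ locAtCentre (Algebra.adjoin S ((t₁ : Set E) ∪ (t₁' : Set E))).toSubring OE,
            OE.valuation y < 1 →
            ∃ c ∈ locAtCentre (Algebra.adjoin S (t : Set E)).toSubring OE, y = h₀ * c) := by
  classical
  haveI : IsDomain S := isDomain_of_isRegularLocalRing S
  haveI : IsNoetherianRing S := hS.isUniversallyCatenaryRing.1
  have hSK : ∀ s : S, algebraMap S E s ∈ K' := fun s => hMK' (hSM s)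
  set B₀ : Subalgebra S E := Algebra.adjoin S ((t₁ : Set E) ∪ (t₁' : Set E)) with hB₀def
  -- `B₀ ⊆ O_E` (integral over `S[t₁] ⊆ O_E`) and `B₀ ⊆ K′`
  have hB₀K : B₀.toSubring ≤ K'.toSubring :=
    model_toSubring_le_of_subset (C := K'.toSubring) hSK
      (Set.union_subset (fun y hy => hMK' (ht₁M hy)) ht₁'K)
  have hB₀O : B₀.toSubring ≤ OE.toSubring := fun y hy =>
    mem_valuationSubring_of_isIntegral_model _ OE ht₁O ((hext y (hB₀K hy)).mpr hy)
  -- a nonzero element of `𝔪_S`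
  have hm : ∃ s ∈ maximalIdeal S, s ≠ 0 := by
    by_contra h
    push Not at h
    have hbot : maximalIdeal S = ⊥ := le_bot_iff.mp fun s hs => h s hs
    have hF : IsField S := (IsLocalRing.isField_iff_maximalIdeal_eq).mpr hbot
    have := ringKrullDim_eq_zero_of_isField hF
    rw [hSdim] at this
    exact absurd this (by decide)
  obtain ⟨s₀, hs₀m, hs₀0⟩ := hm
  have hs₀E0 : algebraMap S E s₀ ≠ 0 := fun h => hs₀0 (hinj (by rw [h, map_zero]))
  have hs₀B : algebraMap S E s₀ ∈ B₀ := B₀.algebraMap_mem s₀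
  -- generators of the centre of `B₀`
  haveI : Algebra.FiniteType S B₀ :=
    (Subalgebra.fg_iff_finiteType _).mp (by
      rw [hB₀def, ← Finset.coe_union]; exact Subalgebra.fg_adjoin_finset _)
  haveI : IsNoetherianRing B₀ := Algebra.FiniteType.isNoetherianRing S B₀
  set P₁ : Ideal B₀ := subringCentre B₀.toSubring OE hB₀O with hP₁def
  obtain ⟨G₀, hG₀⟩ := (inferInstance : IsNoetherianRing B₀).noetherian P₁
  set gens : Finset E := insert (algebraMap S E s₀) (G₀.image (fun g : B₀ => (g : E))) with hgens
  have hgensB : ∀ g ∈ gens, g ∈ B₀ := by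
    intro g hg
    rcases Finset.mem_insert.mp hg with rfl | hg
    · exact hs₀B
    · obtain ⟨g', -, rfl⟩ := Finset.mem_image.mp hg; exact g'.2
  have hgensv : ∀ g ∈ gens, OE.valuation g < 1 := by
    intro g hg
    rcases Finset.mem_insert.mp hg with rfl | hg
    · exact hdom s₀ hs₀m
    · obtain ⟨g', hg', rfl⟩ := Finset.mem_image.mp hg
      have : g' ∈ P₁ := by rw [← hG₀]; exact Ideal.subset_span hg'
      exact (mem_subringCentre_iff hB₀O g').mp this
  -- `h₀`: a generator of largest value
  obtain ⟨h₀, hh₀gens, hh₀max⟩ :=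
    gens.exists_max_image (fun g => OE.valuation g) ⟨_, Finset.mem_insert_self _ _⟩
  have hvh₀ : OE.valuation h₀ < 1 := hgensv h₀ hh₀gens
  have hh₀0 : h₀ ≠ 0 := by
    intro h0
    have := hh₀max _ (Finset.mem_insert_self _ _)
    rw [h0, map_zero, le_zero_iff] at this
    exact hs₀E0 ((Valuation.zero_iff _).mp this)
  have hvh₀0 : OE.valuation h₀ ≠ 0 := fun h => hh₀0 ((Valuation.zero_iff _).mp h)
  -- the elements to be added: `g / h₀` and `t₁ ∪ t₁′`
  set P : Finset E := gens.image (fun g => g / h₀) ∪ (t₁ ∪ t₁') with hPdef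
  have hPK : (P : Set E) ⊆ K' := by
    intro y hy
    rw [hPdef, Finset.coe_union, Finset.coe_image, Finset.coe_union] at hy
    rcases hy with ⟨g, hg, rfl⟩ | hy
    · exact K'.div_mem (hB₀K (hgensB g hg)) (hB₀K (hgensB h₀ hh₀gens))
    · rcases hy with hy | hy
      · exact hMK' (ht₁M hy)
      · exact ht₁'K hy
  have hPO : ∀ y ∈ P, y ∈ OE := by
    intro y hy
    rw [hPdef, Finset.mem_union, Finset.mem_image, Finset.mem_union] at hy
    rcases hy with ⟨g, hg, rfl⟩ | hy
    · rw [← OE.valuation_le_one_iff, map_div₀]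
      exact div_le_one_of_le₀ (hh₀max g hg) zero_le
    · rcases hy with hy | hy
      · exact hB₀O (Algebra.subset_adjoin (Or.inl hy))
      · exact hB₀O (Algebra.subset_adjoin (Or.inr hy))
  -- the refined local uniformization
  obtain ⟨t₀, ht₀K, hKcl₀, hT₀O, hreg₀⟩ := hLUK'
  obtain ⟨t, -, hPt, htK, -, hTO, hreg⟩ :=
    exists_lu_superset h44 hS hSdim hinj OE hSO hdom hres K' hSK P hPK hPO t₀ ht₀K hKcl₀ hT₀O
      ((isRegularLocalRing_locAtCentre_iff hT₀O).mpr hreg₀)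
  have hB₀t : B₀ ≤ Algebra.adjoin S (t : Set E) := by
    rw [hB₀def]
    refine Algebra.adjoin_le fun y hy => Algebra.subset_adjoin (hPt ?_)
    rw [hPdef, Finset.mem_union, Finset.mem_union]
    rcases hy with hy | hy
    · exact Or.inr (Or.inl hy)
    · exact Or.inr (Or.inr hy)
  have hAR : locAtCentre B₀.toSubring OE ≤ locAtCentre (Algebra.adjoin S (t : Set E)).toSubring OE :=
    locAtCentre_mono OE (fun y hy => hB₀t hy)
  -- the common denominator `q`
  have hfrac : ∀ z : E, z ∈ K' → ∃ a ∈ B₀.toSubring, ∃ b ∈ B₀.toSubring, b ≠ 0 ∧ z = a / b :=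
    fun z hz => exists_div_eq_of_isIntegral_mem hinj (Algebra.adjoin S (t₁ : Set E)) B₀
      (Algebra.adjoin_mono Set.subset_union_left) K'
      (model_toSubring_le_of_subset (C := K'.toSubring) hSK fun y hy => hMK' (ht₁M hy))
      (fun x hxK hint => (hext x hxK).mp hint) hz
  choose num hnum den hden hden0 hzeq using hfrac
  refine ⟨t, htK, hB₀t, hTO, hreg, hAR, ⟨∏ z ∈ t.attach, den z (htK z.2),
    Subalgebra.prod_mem _ fun z _ => hden _ _,
    Finset.prod_ne_zero_iff.mpr fun z _ => hden0 _ _, fun z hz => ?_⟩,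
    ⟨h₀, hgensB h₀ hh₀gens, hh₀0, hvh₀, fun y hy hvy => ?_⟩⟩
  · -- `q z ∈ B₀`
    have hzt : (⟨z, hz⟩ : {w // w ∈ t}) ∈ t.attach := Finset.mem_attach _ _
    have hzden : z * den z (htK hz) = num z (htK hz) :=
      (eq_div_iff (hden0 z (htK hz))).mp (hzeq z (htK hz))
    rw [← Finset.mul_prod_erase _ _ hzt, mul_comm, ← mul_assoc]
    change z * den z (htK hz) * _ ∈ _
    rw [hzden]
    exact Subalgebra.mul_mem _ (hnum _ _) (Subalgebra.prod_mem _ fun w _ => hden _ _)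
  · -- `m_{R₁′} R_t ⊆ h₀ R_t`
    obtain ⟨p, hp, s, hs, hvs, rfl⟩ := hy
    have hvp : OE.valuation p < 1 := by rwa [map_div₀, hvs, div_one] at hvy
    have hpP : (⟨p, hp⟩ : B₀) ∈ P₁ := (mem_subringCentre_iff hB₀O _).mpr hvp
    -- the generators lie in `h₀ R_t`
    let ι : B₀ →+* locAtCentre (Algebra.adjoin S (t : Set E)).toSubring OE :=
      (Subring.inclusion (le_locAtCentre _ OE)).comp
        (Subring.inclusion (show B₀.toSubring ≤ (Algebra.adjoin S (t : Set E)).toSubring from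
          fun y hy => hB₀t hy))
    have hιE : ∀ b : B₀, ((ι b : locAtCentre (Algebra.adjoin S (t : Set E)).toSubring OE) : E) =
        (b : E) := fun b => rfl
    have hh₀R : h₀ ∈ locAtCentre (Algebra.adjoin S (t : Set E)).toSubring OE :=
      hAR (le_locAtCentre _ _ (hgensB h₀ hh₀gens))
    have hle : P₁.map ι ≤ Ideal.span {⟨h₀, hh₀R⟩} := by
      rw [← hG₀, Ideal.map_span, Ideal.span_le]
      rintro _ ⟨g, hg, rfl⟩
      have hgq : ((g : E) / h₀) ∈ (t : Set E) := hPt (by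
        rw [hPdef, Finset.mem_union, Finset.mem_image]
        exact Or.inl ⟨g, Finset.mem_insert_of_mem (Finset.mem_image_of_mem _ hg), rfl⟩)
      refine Ideal.mem_span_singleton'.mpr ⟨⟨(g : E) / h₀, le_locAtCentre _ _
        (Algebra.subset_adjoin hgq)⟩, Subtype.ext ?_⟩
      change (g : E) / h₀ * h₀ = ((ι g : locAtCentre _ OE) : E)
      rw [hιE, div_mul_cancel₀ _ hh₀0]
    obtain ⟨c, hc⟩ := Ideal.mem_span_singleton'.mp (hle (Ideal.mem_map_of_mem ι hpP))
    have hcE : (c : E) * h₀ = p := by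
      have := congrArg Subtype.val hc
      simpa only [Subring.coe_mul, hιE] using this
    have hs0 : s ≠ 0 := ne_zero_of_valuation_eq_one hvs
    refine ⟨(c : E) / s, by
      rw [div_eq_mul_inv]
      exact Subring.mul_mem _ c.2 (inv_mem_locAtCentre (hAR (le_locAtCentre _ _ hs)) hvs), ?_⟩
    rw [← hcE]
    field_simp

end PreStage

end Literature.AlgebraicGeometry.Resolution

end
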